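import Summits.QuantumAdvantage.QuantumAdvantage.Theorems.CertDialM
import HarnessLib

/-!
# CertDial — part O (§15a–b): THE QUINT LAWS and the TWO-BLOCK PRODUCT FAMILY `T9(a)` with its nine laws

§15a.  Two more weight-5 pages of the light-input atlas (even `n`, `a` odd, `3 ≤ a`, `a + 3 ≤ n`): `quintA n a = 1_{0,1,2,a,a+1}` with kernel
vector `{0} ∪ {odd b ≤ a} ∪ {even b ≥ a+1}` and `quintB n a = 1_{0,1,2,a+1,a+2}` with kernel vector `{1} ∪ {even b ∈ [2, a+1]} ∪ {odd b ≥ a+2}`,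
both with sign bit `0` (`rel_quintA_iff`, `rel_quintB_iff`; proofs as for the pent law of §13a: kernel condition, two inner edges, four common ones).
§15b.  THE TWO-BLOCK PRODUCT FAMILY `T9(a) = {X ∪ Y : X ∈ {{0},{1},{0,1,2}}, Y ∈ {∅, {a,a+1}, {a+1,a+2}}}` — nine odd-class inputs of
weights `1,3,3,1,3,3,3,5,5` on the two BLOCKS `{0,1,2}` and `{a,a+1,a+2}` (`tb₀₀ … tb₂₂`; family found numerically by the cell's census seat,
K55 «ninelights-v1» §B, as a shorter and more general certificate than §14's nine lights) — and its nine laws with EXPLICIT electorates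
(`rel_tb₀₀_iff … rel_tb₁₂_iff` from the tree's weight-1 and two-one laws, `rel_quintA_iff`, `rel_quintB_iff`): targets `0,1,1,0,1,1,1,0,0` (odd sum).
Part P turns them into the certificate against TWO-BLOCK-LOCAL answer maps; part Q places the two blocks anywhere on the ring and derives
the weight-5 law for every answer map of bounded fan-in.  Imports part M.  Nothing here touches 27432.
`lean check` on the tree closure: rc 0, no warnings, no placeholders; axioms standard (`propext`, `Classical.choice`, `Quot.sound`).
-/

set_option linter.dupNamespace false
set_option linter.style.longLine false

noncomputable section
open scoped Classical

namespace Summit.QuantumAdvantage.QuantumAdvantage.Theorems.CertDial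
open Finset
open Literature.Computability.QuantumComplexity Literature.Computability.QuantumComplexity.RingHLF
open Summit.QuantumAdvantage.AdviceFreeQNC0
open Literature.Computability.MetaComplexity Literature.Computability.MetaComplexity.Smolensky
open Summit.QuantumAdvantage.QuantumAdvantage.Theorems.ParityDial (par offs)

variable {n : ℕ}

/-! ### §15a The quint laws (weight 5, shapes `{0,1,2,a,a+1}` and `{0,1,2,a+1,a+2}`, `a` odd) -/

/-- the quint input `1_{0,1,2,a,a+1}`. -/
def quintA (n a : ℕ) : Fin n → Bool := fun b => decide ((b : ℕ) ≤ 2 ∨ (b : ℕ) = a ∨ (b : ℕ) = a + 1)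

/-- the quint input `1_{0,1,2,a+1,a+2}`. -/
def quintB (n a : ℕ) : Fin n → Bool := fun b => decide ((b : ℕ) ≤ 2 ∨ (b : ℕ) = a + 1 ∨ (b : ℕ) = a + 2)

/-- kernel vector of `quintA`: `{0} ∪ {odd b ≤ a} ∪ {even b ≥ a+1}`. -/
def qvecA (n a : ℕ) : Fin n → Bool := fun b =>
  decide ((b : ℕ) = 0 ∨ ((b : ℕ) % 2 = 1 ∧ (b : ℕ) ≤ a) ∨ ((b : ℕ) % 2 = 0 ∧ a + 1 ≤ (b : ℕ)))

/-- kernel vector of `quintB`: `{1} ∪ {even b ∈ [2, a+1]} ∪ {odd b ≥ a+2}`. -/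
def qvecB (n a : ℕ) : Fin n → Bool := fun b =>
  decide ((b : ℕ) = 1 ∨ ((b : ℕ) % 2 = 0 ∧ 2 ≤ (b : ℕ) ∧ (b : ℕ) ≤ a + 1) ∨ ((b : ℕ) % 2 = 1 ∧ a + 2 ≤ (b : ℕ)))

/-- `quintA` has weight 5 … -/
theorem card_quintA {a : ℕ} (ha : 3 ≤ a) (han : a + 3 ≤ n) : (univ.filter fun b : Fin n => quintA n a b = true).card = 5 := by
  have hset : (univ.filter fun b : Fin n => quintA n a b = true) =
      {⟨0, by omega⟩, ⟨1, by omega⟩, ⟨2, by omega⟩, ⟨a, by omega⟩, ⟨a + 1, by omega⟩} := by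
    ext b
    simp only [Finset.mem_filter, Finset.mem_univ, true_and, quintA, decide_eq_true_eq, Finset.mem_insert, Finset.mem_singleton,
      Fin.ext_iff]
    omega
  rw [hset, Finset.card_insert_of_notMem (by simp [Fin.ext_iff]; omega), Finset.card_insert_of_notMem (by simp [Fin.ext_iff]; omega),
    Finset.card_insert_of_notMem (by simp [Fin.ext_iff]; omega), Finset.card_pair (by simp [Fin.ext_iff])]

/-- … and so has `quintB`. -/
theorem card_quintB {a : ℕ} (ha : 3 ≤ a) (han : a + 3 ≤ n) : (univ.filter fun b : Fin n => quintB n a b = true).card = 5 := by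
  have hset : (univ.filter fun b : Fin n => quintB n a b = true) =
      {⟨0, by omega⟩, ⟨1, by omega⟩, ⟨2, by omega⟩, ⟨a + 1, by omega⟩, ⟨a + 2, by omega⟩} := by
    ext b
    simp only [Finset.mem_filter, Finset.mem_univ, true_and, quintB, decide_eq_true_eq, Finset.mem_insert, Finset.mem_singleton,
      Fin.ext_iff]
    omega
  rw [hset, Finset.card_insert_of_notMem (by simp [Fin.ext_iff]), Finset.card_insert_of_notMem (by simp [Fin.ext_iff]; omega),
    Finset.card_insert_of_notMem (by simp [Fin.ext_iff]; omega), Finset.card_pair (by simp [Fin.ext_iff])]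

/-- both quints are in the odd class (even `n`). -/
theorem oddZeros_quint (he : n % 2 = 0) {a : ℕ} (ha : 3 ≤ a) (han : a + 3 ≤ n) : OddZeros (quintA n a) ∧ OddZeros (quintB n a) := by
  unfold OddZeros
  have hA := Finset.card_filter_add_card_filter_not (s := (univ : Finset (Fin n))) (fun b : Fin n => quintA n a b = true)
  have hB := Finset.card_filter_add_card_filter_not (s := (univ : Finset (Fin n))) (fun b : Fin n => quintB n a b = true)
  rw [card_quintA ha han, Finset.card_univ, Fintype.card_fin] at hA
  rw [card_quintB ha han, Finset.card_univ, Fintype.card_fin] at hB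
  rw [Finset.filter_congr fun b _ => show (quintA n a b = false) ↔ ¬ (quintA n a b = true) by simp,
    Finset.filter_congr fun b _ => show (quintB n a b = false) ↔ ¬ (quintB n a b = true) by simp]
  omega

/-- the weights in the route's currency. -/
theorem wt_quint {a : ℕ} (ha : 3 ≤ a) (han : a + 3 ≤ n) : LightDial.wt (quintA n a) = 5 ∧ LightDial.wt (quintB n a) = 5 := by
  unfold LightDial.wt; exact ⟨card_quintA ha han, card_quintB ha han⟩

/-- the kernel conditions (even `n`, odd `a ≥ 3`, `a + 3 ≤ n`). -/
theorem inKernel_qvec (he : n % 2 = 0) {a : ℕ} (ha2 : a % 2 = 1) (ha : 3 ≤ a) (han : a + 3 ≤ n) :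
    InKernel (quintA n a) (qvecA n a) ∧ InKernel (quintB n a) (qvecB n a) := by
  constructor <;> intro b <;> have hb := b.isLt <;> have hp := LightConeWindowHard.prv_val b <;>
    have hq := LightConeWindowHard.nxt_val b <;> rw [xor_xor_and_eq_false_iff]
  · simp only [qvecA, quintA, decide_eq_true_eq]
    split_ifs at hp hq <;> omega
  · simp only [qvecB, quintB, decide_eq_true_eq]
    split_ifs at hp hq <;> omega

/-- the kernel vectors are nonzero. -/
theorem qvec_ne_zero (hn : 2 ≤ n) (a : ℕ) : (qvecA n a ≠ fun _ => false) ∧ (qvecB n a ≠ fun _ => false) := by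
  constructor <;> intro h
  · have := congrFun h ⟨0, by omega⟩; simp [qvecA] at this
  · have := congrFun h ⟨1, by omega⟩; simp [qvecB] at this

/-- two ring edges inside each kernel vector: `{0,1}`, `{a,a+1}`, resp. `{1,2}`, `{a+1,a+2}`. -/
theorem edgesIn_qvec (he : n % 2 = 0) {a : ℕ} (ha2 : a % 2 = 1) (ha : 3 ≤ a) (han : a + 3 ≤ n) :
    edgesIn (qvecA n a) = 2 ∧ edgesIn (qvecB n a) = 2 := by
  unfold edgesIn
  constructor <;> rw [Finset.card_eq_two]
  · refine ⟨⟨0, by omega⟩, ⟨a, by omega⟩, ?_, ?_⟩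
    · simp [Fin.ext_iff]; omega
    · ext b
      have hb := b.isLt
      have hq := LightConeWindowHard.nxt_val b
      simp only [Finset.mem_filter, Finset.mem_univ, true_and, qvecA, decide_eq_true_eq, Finset.mem_insert, Finset.mem_singleton,
        Fin.ext_iff]
      split_ifs at hq <;> omega
  · refine ⟨⟨1, by omega⟩, ⟨a + 1, by omega⟩, ?_, ?_⟩
    · simp [Fin.ext_iff]; omega
    · ext b
      have hb := b.isLt
      have hq := LightConeWindowHard.nxt_val b
      simp only [Finset.mem_filter, Finset.mem_univ, true_and, qvecB, decide_eq_true_eq, Finset.mem_insert, Finset.mem_singleton,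
        Fin.ext_iff]
      split_ifs at hq <;> omega

/-- four common ones each: `0,1,a,a+1`, resp. `1,2,a+1,a+2`. -/
theorem wtAnd_qvec {a : ℕ} (ha2 : a % 2 = 1) (ha : 3 ≤ a) (han : a + 3 ≤ n) :
    wtAnd (quintA n a) (qvecA n a) = 4 ∧ wtAnd (quintB n a) (qvecB n a) = 4 := by
  unfold wtAnd
  have hA : (univ.filter fun b : Fin n => quintA n a b = true ∧ qvecA n a b = true) =
      {⟨0, by omega⟩, ⟨1, by omega⟩, ⟨a, by omega⟩, ⟨a + 1, by omega⟩} := by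
    ext b
    simp only [Finset.mem_filter, Finset.mem_univ, true_and, quintA, qvecA, decide_eq_true_eq, Finset.mem_insert,
      Finset.mem_singleton, Fin.ext_iff]
    omega
  have hB : (univ.filter fun b : Fin n => quintB n a b = true ∧ qvecB n a b = true) =
      {⟨1, by omega⟩, ⟨2, by omega⟩, ⟨a + 1, by omega⟩, ⟨a + 2, by omega⟩} := by
    ext b
    simp only [Finset.mem_filter, Finset.mem_univ, true_and, quintB, qvecB, decide_eq_true_eq, Finset.mem_insert,
      Finset.mem_singleton, Fin.ext_iff]
    omega
  rw [hA, hB, Finset.card_insert_of_notMem (by simp [Fin.ext_iff]; omega), Finset.card_insert_of_notMem (by simp [Fin.ext_iff]; omega),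
    Finset.card_pair (by simp [Fin.ext_iff]), Finset.card_insert_of_notMem (by simp [Fin.ext_iff]; omega),
    Finset.card_insert_of_notMem (by simp [Fin.ext_iff]; omega), Finset.card_pair (by simp [Fin.ext_iff])]
  exact ⟨rfl, rfl⟩

/-- so both sign bits are `0`. -/
theorem signBit_qvec (he : n % 2 = 0) {a : ℕ} (ha2 : a % 2 = 1) (ha : 3 ≤ a) (han : a + 3 ≤ n) :
    signBit (quintA n a) (qvecA n a) = 0 ∧ signBit (quintB n a) (qvecB n a) = 0 := by
  unfold signBit
  rw [(edgesIn_qvec he ha2 ha han).1, (edgesIn_qvec he ha2 ha han).2, (wtAnd_qvec (n := n) ha2 ha han).1, (wtAnd_qvec (n := n) ha2 ha han).2]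
  exact ⟨rfl, rfl⟩

/-- ★ QUINT LAW A.  Even `n`, odd `a ≥ 3`, `a + 3 ≤ n`, `x = 1_{0,1,2,a,a+1}`, ANY answer `z`:
`Rel x z ⟺ #{b : (b = 0 ∨ (b odd ∧ b ≤ a) ∨ (b even ∧ b ≥ a+1)), z b = 1}` is even. -/
theorem rel_quintA_iff (he : n % 2 = 0) {a : ℕ} (ha2 : a % 2 = 1) (ha : 3 ≤ a) (han : a + 3 ≤ n) (z : Fin n → Bool) :
    Rel (quintA n a) z ↔ (univ.filter fun b : Fin n =>
      ((b : ℕ) = 0 ∨ ((b : ℕ) % 2 = 1 ∧ (b : ℕ) ≤ a) ∨ ((b : ℕ) % 2 = 0 ∧ a + 1 ≤ (b : ℕ))) ∧ z b = true).card % 2 = 0 := by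
  rw [rel_iff_of_explicit (by omega) (oddZeros_quint he ha han).1 (inKernel_qvec he ha2 ha han).1 (qvec_ne_zero (by omega) a).1 z,
    (signBit_qvec he ha2 ha han).1]
  unfold dot2
  rw [Finset.filter_congr fun (b : Fin n) _ => show (qvecA n a b = true ∧ z b = true) ↔
      (((b : ℕ) = 0 ∨ ((b : ℕ) % 2 = 1 ∧ (b : ℕ) ≤ a) ∨ ((b : ℕ) % 2 = 0 ∧ a + 1 ≤ (b : ℕ))) ∧ z b = true) by simp [qvecA]]

/-- ★ QUINT LAW B.  Even `n`, odd `a ≥ 3`, `a + 3 ≤ n`, `x = 1_{0,1,2,a+1,a+2}`, ANY answer `z`: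
`Rel x z ⟺ #{b : (b = 1 ∨ (b even ∧ 2 ≤ b ≤ a+1) ∨ (b odd ∧ b ≥ a+2)), z b = 1}` is even. -/
theorem rel_quintB_iff (he : n % 2 = 0) {a : ℕ} (ha2 : a % 2 = 1) (ha : 3 ≤ a) (han : a + 3 ≤ n) (z : Fin n → Bool) :
    Rel (quintB n a) z ↔ (univ.filter fun b : Fin n =>
      ((b : ℕ) = 1 ∨ ((b : ℕ) % 2 = 0 ∧ 2 ≤ (b : ℕ) ∧ (b : ℕ) ≤ a + 1) ∨ ((b : ℕ) % 2 = 1 ∧ a + 2 ≤ (b : ℕ))) ∧ z b = true).card % 2 = 0 := by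
  rw [rel_iff_of_explicit (by omega) (oddZeros_quint he ha han).2 (inKernel_qvec he ha2 ha han).2 (qvec_ne_zero (by omega) a).2 z,
    (signBit_qvec he ha2 ha han).2]
  unfold dot2
  rw [Finset.filter_congr fun (b : Fin n) _ => show (qvecB n a b = true ∧ z b = true) ↔
      (((b : ℕ) = 1 ∨ ((b : ℕ) % 2 = 0 ∧ 2 ≤ (b : ℕ) ∧ (b : ℕ) ≤ a + 1) ∨ ((b : ℕ) % 2 = 1 ∧ a + 2 ≤ (b : ℕ))) ∧ z b = true) by simp [qvecB]]

/-! ### §15b The two-block product family `T9(a)` and its nine laws -/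

/-- the one-point input `1_{j}`. -/
def pt (n j : ℕ) : Fin n → Bool := fun b => decide ((b : ℕ) = j)

/-- `T9(a)`, row `X = {0}`: `tb₀₀ = 1_{0}`, `tb₀₁ = 1_{0,a,a+1}`, `tb₀₂ = 1_{0,a+1,a+2}`. -/
def tb₀₀ (n a : ℕ) : Fin n → Bool := pt n (0 * a)
/-- see `tb₀₀`. -/
def tb₀₁ (n a : ℕ) : Fin n → Bool := trip n 0 a (a + 1)
/-- see `tb₀₀`. -/
def tb₀₂ (n a : ℕ) : Fin n → Bool := trip n 0 (a + 1) (a + 2)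
/-- `T9(a)`, row `X = {1}`: `tb₁₀ = 1_{1}`, `tb₁₁ = 1_{1,a,a+1}`, `tb₁₂ = 1_{1,a+1,a+2}`. -/
def tb₁₀ (n a : ℕ) : Fin n → Bool := pt n (1 + 0 * a)
/-- see `tb₁₀`. -/
def tb₁₁ (n a : ℕ) : Fin n → Bool := trip n 1 a (a + 1)
/-- see `tb₁₀`. -/
def tb₁₂ (n a : ℕ) : Fin n → Bool := trip n 1 (a + 1) (a + 2)
/-- `T9(a)`, row `X = {0,1,2}`: `tb₂₀ = 1_{0,1,2}`, `tb₂₁ = quintA`, `tb₂₂ = quintB`. -/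
def tb₂₀ (n a : ℕ) : Fin n → Bool := trip n 0 1 (2 + 0 * a)

/-- the one-point input is the tree's `single`. -/
theorem pt_eq_single {j : ℕ} (hj : j < n) : pt n j = single ⟨j, hj⟩ := by
  funext b; simp [pt, single, Fin.ext_iff]

/-- its weight is `1` and it lies in the odd class (even `n`). -/
theorem pt_light (he : n % 2 = 0) {j : ℕ} (hj : j < n) : OddZeros (pt n j) ∧ LightDial.wt (pt n j) = 1 := by
  refine ⟨by rw [pt_eq_single hj]; exact oddZeros_single he _, ?_⟩
  unfold LightDial.wt
  rw [Finset.card_eq_one]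
  exact ⟨⟨j, hj⟩, by ext b; simp [pt, Fin.ext_iff]⟩

/-- LAW `tb₀₀ = 1_{0}`: `Rel ⟺ #{b odd : z b = 1}` even. -/
theorem rel_tb₀₀_iff (he : n % 2 = 0) (hn : 3 ≤ n) (a : ℕ) (z : Fin n → Bool) :
    Rel (tb₀₀ n a) z ↔ (univ.filter fun b : Fin n => (b : ℕ) % 2 = 1 ∧ z b = true).card % 2 = 0 := by
  rw [tb₀₀, rel_mono_iff he hn (q := true) (pt_light he (j := 0 * a) (by omega)).1 (fun b hb => by
    simp only [pt, Nat.zero_mul, decide_eq_true_eq] at hb; unfold par; rw [hb]; decide) z]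
  rw [Finset.filter_congr fun (b : Fin n) _ => show (par b ≠ true ∧ z b = true) ↔ ((b : ℕ) % 2 = 1 ∧ z b = true) by
    unfold par; rw [ne_eq, decide_eq_true_eq]; exact and_congr_left' (by omega)]

/-- LAW `tb₁₀ = 1_{1}`: `Rel ⟺ #{b even : z b = 1}` even. -/
theorem rel_tb₁₀_iff (he : n % 2 = 0) (hn : 3 ≤ n) (a : ℕ) (z : Fin n → Bool) :
    Rel (tb₁₀ n a) z ↔ (univ.filter fun b : Fin n => (b : ℕ) % 2 = 0 ∧ z b = true).card % 2 = 0 := by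
  rw [tb₁₀, rel_mono_iff he hn (q := false) (pt_light he (j := 1 + 0 * a) (by omega)).1 (fun b hb => by
    simp only [pt, Nat.zero_mul, Nat.add_zero, decide_eq_true_eq] at hb; unfold par; rw [hb]; decide) z]
  rw [Finset.filter_congr fun (b : Fin n) _ => show (par b ≠ false ∧ z b = true) ↔ ((b : ℕ) % 2 = 0 ∧ z b = true) by
    unfold par; rw [ne_eq, decide_eq_false_iff_not, not_not]]

/-- `tb₂₀ = 1_{0,1,2}` as a two-one input at `2`. -/
theorem tb₂₀_eq_triAt (a : ℕ) (hn : 4 ≤ n) : tb₂₀ n a = triAt (⟨2, by omega⟩ : Fin n) (n - 2) (n - 1) := by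
  funext b; have hb := b.isLt
  simp only [tb₂₀, trip, triAt, offs, decide_eq_decide]
  split_ifs <;> omega

/-- LAW `tb₂₀ = 1_{0,1,2}`: `Rel ⟺ #{b ≠ 1 : z b = 1}` odd. -/
theorem rel_tb₂₀_iff (he : n % 2 = 0) (hn : 4 ≤ n) (a : ℕ) (z : Fin n → Bool) :
    Rel (tb₂₀ n a) z ↔ (univ.filter fun b : Fin n => (b : ℕ) ≠ 1 ∧ z b = true).card % 2 = 1 := by
  rw [tb₂₀_eq_triAt a hn, rel_triAt_iff he (by omega) _ (by omega) (by omega) (by omega) (by omega) (by omega) z]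
  rw [Finset.filter_congr fun (b : Fin n) _ => show
      ((offs b (⟨2, by omega⟩ : Fin n) % 2 = 0 ∨ offs b (⟨2, by omega⟩ : Fin n) < n - 2) ∧ z b = true) ↔ ((b : ℕ) ≠ 1 ∧ z b = true) by
    have hb := b.isLt
    simp only [offs]
    constructor
    · rintro ⟨h, hz⟩; refine ⟨?_, hz⟩; split_ifs at h <;> omega
    · rintro ⟨h, hz⟩; refine ⟨?_, hz⟩; split_ifs <;> omega]

/-- `tb₀₁ = 1_{0,a,a+1}` as a two-one input at `a+1`. -/
theorem tb₀₁_eq_triAt {a : ℕ} (ha : 3 ≤ a) (han : a + 3 ≤ n) : tb₀₁ n a = triAt (⟨a + 1, by omega⟩ : Fin n) (n - a - 1) (n - 1) := by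
  funext b; have hb := b.isLt
  simp only [tb₀₁, trip, triAt, offs, decide_eq_decide]
  split_ifs <;> omega

/-- LAW `tb₀₁ = 1_{0,a,a+1}`: `Rel ⟺ #{b : (b even ∨ a+1 ≤ b), z b = 1}` odd. -/
theorem rel_tb₀₁_iff (he : n % 2 = 0) {a : ℕ} (ha2 : a % 2 = 1) (ha : 3 ≤ a) (han : a + 3 ≤ n) (z : Fin n → Bool) :
    Rel (tb₀₁ n a) z ↔ (univ.filter fun b : Fin n => ((b : ℕ) % 2 = 0 ∨ a + 1 ≤ (b : ℕ)) ∧ z b = true).card % 2 = 1 := by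
  rw [tb₀₁_eq_triAt ha han, rel_triAt_iff he (by omega) _ (by omega) (by omega) (by omega) (by omega) (by omega) z]
  rw [Finset.filter_congr fun (b : Fin n) _ => show
      ((offs b (⟨a + 1, by omega⟩ : Fin n) % 2 = 0 ∨ offs b (⟨a + 1, by omega⟩ : Fin n) < n - a - 1) ∧ z b = true) ↔
      (((b : ℕ) % 2 = 0 ∨ a + 1 ≤ (b : ℕ)) ∧ z b = true) by
    have hb := b.isLt
    simp only [offs]
    constructor
    · rintro ⟨h, hz⟩; refine ⟨?_, hz⟩; split_ifs at h <;> omega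
    · rintro ⟨h, hz⟩; refine ⟨?_, hz⟩; split_ifs <;> omega]

/-- LAW `tb₀₂ = 1_{0,a+1,a+2}` (normal form `tri n (a+1) (a+2)`): `Rel ⟺ #{b : (b even ∨ b ≤ a), z b = 1}` odd. -/
theorem rel_tb₀₂_iff (he : n % 2 = 0) {a : ℕ} (ha2 : a % 2 = 1) (ha : 3 ≤ a) (han : a + 3 ≤ n) (z : Fin n → Bool) :
    Rel (tb₀₂ n a) z ↔ (univ.filter fun b : Fin n => ((b : ℕ) % 2 = 0 ∨ (b : ℕ) ≤ a) ∧ z b = true).card % 2 = 1 := by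
  rw [show tb₀₂ n a = tri n (a + 1) (a + 2) from rfl, rel_tri_iff he (by omega) (by omega) (by omega) (by omega) (by omega) (by omega) z]
  rw [Finset.filter_congr fun (b : Fin n) _ => show (((b : ℕ) % 2 = 0 ∨ (b : ℕ) < a + 1) ∧ z b = true) ↔
      (((b : ℕ) % 2 = 0 ∨ (b : ℕ) ≤ a) ∧ z b = true) by rw [Nat.lt_succ_iff]]

/-- `tb₁₁ = 1_{1,a,a+1}` as a two-one input at `1`. -/
theorem tb₁₁_eq_triAt {a : ℕ} (ha : 3 ≤ a) (han : a + 3 ≤ n) : tb₁₁ n a = triAt (⟨1, by omega⟩ : Fin n) (a - 1) a := by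
  funext b; have hb := b.isLt
  simp only [tb₁₁, trip, triAt, offs, decide_eq_decide]
  split_ifs <;> omega

/-- LAW `tb₁₁ = 1_{1,a,a+1}`: `Rel ⟺ #{b : (b odd ∨ 1 ≤ b ≤ a-1), z b = 1}` odd. -/
theorem rel_tb₁₁_iff (he : n % 2 = 0) {a : ℕ} (ha2 : a % 2 = 1) (ha : 3 ≤ a) (han : a + 3 ≤ n) (z : Fin n → Bool) :
    Rel (tb₁₁ n a) z ↔ (univ.filter fun b : Fin n => ((b : ℕ) % 2 = 1 ∨ (1 ≤ (b : ℕ) ∧ (b : ℕ) ≤ a - 1)) ∧ z b = true).card % 2 = 1 := by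
  rw [tb₁₁_eq_triAt ha han, rel_triAt_iff he (by omega) _ (by omega) (by omega) (by omega) (by omega) (by omega) z]
  rw [Finset.filter_congr fun (b : Fin n) _ => show
      ((offs b (⟨1, by omega⟩ : Fin n) % 2 = 0 ∨ offs b (⟨1, by omega⟩ : Fin n) < a - 1) ∧ z b = true) ↔
      (((b : ℕ) % 2 = 1 ∨ (1 ≤ (b : ℕ) ∧ (b : ℕ) ≤ a - 1)) ∧ z b = true) by
    have hb := b.isLt
    simp only [offs]
    constructor
    · rintro ⟨h, hz⟩; refine ⟨?_, hz⟩; split_ifs at h <;> omega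
    · rintro ⟨h, hz⟩; refine ⟨?_, hz⟩; split_ifs <;> omega]

/-- `tb₁₂ = 1_{1,a+1,a+2}` as a two-one input at `a+2`. -/
theorem tb₁₂_eq_triAt {a : ℕ} (ha : 3 ≤ a) (han : a + 3 ≤ n) : tb₁₂ n a = triAt (⟨a + 2, by omega⟩ : Fin n) (n - a - 1) (n - 1) := by
  funext b; have hb := b.isLt
  simp only [tb₁₂, trip, triAt, offs, decide_eq_decide]
  split_ifs <;> omega

/-- LAW `tb₁₂ = 1_{1,a+1,a+2}`: `Rel ⟺ #{b : (b odd ∨ a+2 ≤ b ∨ b = 0), z b = 1}` odd. -/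
theorem rel_tb₁₂_iff (he : n % 2 = 0) {a : ℕ} (ha2 : a % 2 = 1) (ha : 3 ≤ a) (han : a + 3 ≤ n) (z : Fin n → Bool) :
    Rel (tb₁₂ n a) z ↔ (univ.filter fun b : Fin n => ((b : ℕ) % 2 = 1 ∨ a + 2 ≤ (b : ℕ) ∨ (b : ℕ) = 0) ∧ z b = true).card % 2 = 1 := by
  rw [tb₁₂_eq_triAt ha han, rel_triAt_iff he (by omega) _ (by omega) (by omega) (by omega) (by omega) (by omega) z]
  rw [Finset.filter_congr fun (b : Fin n) _ => show
      ((offs b (⟨a + 2, by omega⟩ : Fin n) % 2 = 0 ∨ offs b (⟨a + 2, by omega⟩ : Fin n) < n - a - 1) ∧ z b = true) ↔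
      (((b : ℕ) % 2 = 1 ∨ a + 2 ≤ (b : ℕ) ∨ (b : ℕ) = 0) ∧ z b = true) by
    have hb := b.isLt
    simp only [offs]
    constructor
    · rintro ⟨h, hz⟩; refine ⟨?_, hz⟩; split_ifs at h <;> omega
    · rintro ⟨h, hz⟩; refine ⟨?_, hz⟩; split_ifs <;> omega]

/-- all nine members of `T9(a)` are odd-class inputs of weight `≤ 5` (even `n`, `3 ≤ a`, `a + 3 ≤ n`). -/
theorem twoBlock_light (he : n % 2 = 0) {a : ℕ} (ha : 3 ≤ a) (han : a + 3 ≤ n) :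
    (OddZeros (tb₀₀ n a) ∧ LightDial.wt (tb₀₀ n a) ≤ 5) ∧ (OddZeros (tb₀₁ n a) ∧ LightDial.wt (tb₀₁ n a) ≤ 5) ∧
    (OddZeros (tb₀₂ n a) ∧ LightDial.wt (tb₀₂ n a) ≤ 5) ∧ (OddZeros (tb₁₀ n a) ∧ LightDial.wt (tb₁₀ n a) ≤ 5) ∧
    (OddZeros (tb₁₁ n a) ∧ LightDial.wt (tb₁₁ n a) ≤ 5) ∧ (OddZeros (tb₁₂ n a) ∧ LightDial.wt (tb₁₂ n a) ≤ 5) ∧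
    (OddZeros (tb₂₀ n a) ∧ LightDial.wt (tb₂₀ n a) ≤ 5) ∧ (OddZeros (quintA n a) ∧ LightDial.wt (quintA n a) ≤ 5) ∧
    (OddZeros (quintB n a) ∧ LightDial.wt (quintB n a) ≤ 5) := by
  have p0 := pt_light he (j := 0 * a) (by omega)
  have p1 := pt_light he (j := 1 + 0 * a) (by omega)
  refine ⟨⟨p0.1, by rw [tb₀₀, p0.2]; omega⟩,
    ⟨oddZeros_trip he (by omega) (by omega) (by omega), (wt_trip (n := n) (by omega) (by omega) (by omega)).le.trans (by omega)⟩,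
    ⟨oddZeros_trip he (by omega) (by omega) (by omega), (wt_trip (n := n) (by omega) (by omega) (by omega)).le.trans (by omega)⟩,
    ⟨p1.1, by rw [tb₁₀, p1.2]; omega⟩,
    ⟨oddZeros_trip he (by omega) (by omega) (by omega), (wt_trip (n := n) (by omega) (by omega) (by omega)).le.trans (by omega)⟩,
    ⟨oddZeros_trip he (by omega) (by omega) (by omega), (wt_trip (n := n) (by omega) (by omega) (by omega)).le.trans (by omega)⟩,
    ⟨oddZeros_trip he (by omega) (by omega) (by omega), (wt_trip (n := n) (by omega) (by omega) (by omega)).le.trans (by omega)⟩,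
    ⟨(oddZeros_quint he ha han).1, (wt_quint (n := n) ha han).1.le⟩, ⟨(oddZeros_quint he ha han).2, (wt_quint (n := n) ha han).2.le⟩⟩

/-! ### Axiom audit -/

/-- info: 'Summit.QuantumAdvantage.QuantumAdvantage.Theorems.CertDial.rel_quintA_iff' depends on axioms: [propext,
 Classical.choice,
 Quot.sound] -/
#guard_msgs in #print axioms rel_quintA_iff

/-- info: 'Summit.QuantumAdvantage.QuantumAdvantage.Theorems.CertDial.rel_tb₁₂_iff' depends on axioms: [propext,
 Classical.choice,
 Quot.sound] -/
#guard_msgs in #print axioms rel_tb₁₂_iff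

end Summit.QuantumAdvantage.QuantumAdvantage.Theorems.CertDial
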